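import Summits.ABC.StewartYu.YuNinetyW80Transfer
import HarnessLib

/-!
# Cell abc-stewartyu, rung F-A1 (M3): the TRANSFER at odd `p` — Gen-3 unit-form engine text ⇒ the
# Yu-2007-quality prime text `Y07Odd` (stub `stub_transferOdd` of the staged route `PadicPrimesKummerThird`)

`Summits/ABC/StewartYu/YuOhSevenTransferOdd.lean` — cell `abc-stewartyu` (seat p2; planner plan-m3 BC3
birth skeleton `Cruxes/Y07Odd/…/Y07Odd_birth.lean`, 2026-08-26T13:01Z).  Hypothesis form with both texts
INLINE and VERBATIM (the pattern of `YuNinetyW80.two_of_w80Engine_int'` before route `W80TwoThirds`):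

* `YuOhSeven.y07Odd_of_genThreeEngineOdd : «GenThreeEngineOdd» → «Y07Odd»` — from an engine bound
  `ord_p(∏ αⱼ^{bⱼ} − 1)·log p ≤ C(m)·(p/log p)·∏ Vⱼ·(W + log p + log 2Vmax)` with `C(m) ≤ c₁^m` for rational
  `p`-adic units (multiplicatively independent, no signed sub-product a square, heights `h(αⱼ) ≤ Vⱼ ≤ Vmax`,
  floor `log 2 ≤ Vⱼ`, `log max(3,|bⱼ|) ≤ W`) at every odd prime, the prime text
  `ord_p(∏_{q∈S} q^{e_q} − 1)·log p < c₆^{#S}·(p/log p)·(log p + log B + log log A)·∏ log q`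
  (`A = max(4, max S)`) with **`c₆ = 3c₁`**.

Bookkeeping = the M2 transfer `YuNinetyW80.residueClass_of_w80Engine` with the Gen-3 garbage:
`αⱼ = qⱼ`, `bⱼ = e_{qⱼ}`, `Vⱼ = log qⱼ` (`h(q) = log q ≥ log 2`), `Vmax = X := log A`, `W = log B`;
`W + log p + log 2X ≤ 2·(log p + log B + log X)` (`log 2 < 1 ≤ log B`), and `2·c₁^m < (3c₁)^m` (`m ≥ 1`).
Everything is [folklore]. WHAT THIS IS NOT: no engine is proved; the crux `Y07Odd` is not moved.
-/

noncomputable section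

open Finset Real Height

namespace Summit.ABC.StewartYu

namespace YuOhSeven

open Summit.ABC.ABC.Theorems

/-- **Transfer at odd `p`: Gen-3 unit-form engine ⇒ `Y07Odd`** (both texts verbatim from the birth
skeleton of crux `Y07Odd`, route `PadicPrimesKummerThird`), with `c₆ = 3c₁`: `S ≃ Fin m`, `αⱼ = qⱼ`
(units at `p ∉ S`, independent and square-free signed sub-products by unique factorisation),
`bⱼ = e_{qⱼ} ≠ 0`-vector, `Vⱼ = log qⱼ`, `Vmax = log A`, `W = log B`. [folklore] -/
theorem y07Odd_of_genThreeEngineOdd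
    (hE : ∃ (C : ℕ → ℝ) (c₁ : ℝ), 1 ≤ c₁ ∧ (∀ m, 0 ≤ C m ∧ C m ≤ c₁ ^ m) ∧
      ∀ (p : ℕ), p.Prime → p ≠ 2 → ∀ (m : ℕ) (α : Fin m → ℚ) (b : Fin m → ℤ) (V : Fin m → ℝ)
        (Vmax W : ℝ),
        (∀ j, α j ≠ 0 ∧ padicValRat p (α j) = 0) →
        (∀ μ : Fin m → ℤ, ∏ j, α j ^ μ j = 1 → μ = 0) →
        (∀ T : Finset (Fin m), T.Nonempty → ¬ IsSquare (∏ j ∈ T, α j) ∧ ¬ IsSquare (-∏ j ∈ T, α j)) →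
        (∀ j, Height.logHeight₁ (α j) ≤ V j) → (∀ j, Real.log 2 ≤ V j) → (∀ j, V j ≤ Vmax) →
        b ≠ 0 → (∀ j, Real.log (max 3 (|b j| : ℝ)) ≤ W) →
        (padicValRat p (∏ j, α j ^ b j - 1) : ℝ) * Real.log p ≤
          C m * ((p : ℝ) / Real.log p) * (∏ j, V j) * (W + Real.log p + Real.log (2 * Vmax))) :
    ∃ c₆ : ℝ, ∀ (p : ℕ), p.Prime → p ≠ 2 → ∀ (S : Finset ℕ), (∀ q ∈ S, q.Prime) → p ∉ S → S.Nonempty →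
      ∀ (e : ℕ → ℤ) (B : ℝ), 3 ≤ B → (∀ q ∈ S, (|e q| : ℝ) ≤ B) →
      ∏ q ∈ S, (q : ℚ) ^ e q ≠ 1 →
      (padicValRat p (∏ q ∈ S, (q : ℚ) ^ e q - 1) : ℝ) * Real.log p <
        c₆ ^ S.card * ((p : ℝ) / Real.log p) *
          (Real.log p + Real.log B + Real.log (Real.log ((max 4 (S.sup id) : ℕ) : ℝ))) *
          ∏ q ∈ S, Real.log (q : ℝ) := by
  classical
  obtain ⟨C, c₁, hc₁, hC, hA⟩ := hE
  refine ⟨3 * c₁, ?_⟩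
  intro p hp hp2 S hS hpS hSne e B hB heB hne1
  haveI := Fact.mk hp
  -- enumeration of `S`
  set m : ℕ := S.card with hm
  have hm1 : 1 ≤ m := Finset.card_pos.mpr hSne
  set φ : Fin m ≃ S := S.equivFin.symm with hφ
  set q : Fin m → ℕ := fun i => (φ i : ℕ) with hqdef
  have hqS : ∀ i, q i ∈ S := fun i => (φ i).2
  have hqP : ∀ i, (q i).Prime := fun i => hS _ (hqS i)
  have hinj : Function.Injective q := fun i j hij => φ.injective (Subtype.ext hij)
  have hqp : ∀ i, q i ≠ p := fun i h => hpS (h ▸ hqS i)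
  have hreidx : ∀ {M : Type} [CommMonoid M] (f : ℕ → M), ∏ i, f (q i) = ∏ x ∈ S, f x := by
    intro M _ f
    rw [← Finset.prod_coe_sort S f]
    exact Fintype.prod_equiv φ (fun i => f (q i)) (fun x => f x) (fun i => rfl)
  -- the data fed to the engine
  set L : ℝ := Real.log p with hL
  set M4 : ℝ := ((max 4 (S.sup id) : ℕ) : ℝ) with hM4
  set X : ℝ := Real.log M4 with hX
  set α : Fin m → ℚ := fun j => (q j : ℚ) with hα
  set b : Fin m → ℤ := fun j => e (q j) with hb
  set V : Fin m → ℝ := fun j => Real.log (q j : ℝ) with hV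
  set Vmax : ℝ := X with hVmax
  set W : ℝ := Real.log B with hW
  -- numerics of `p ≥ 3`
  have hp3 : 3 ≤ p := by have := hp.two_le; omega
  have hp3R : (3 : ℝ) ≤ p := by exact_mod_cast hp3
  have hpR0 : (0 : ℝ) < p := by linarith
  have hL1 : 1 < L := by
    have h3 : (1 : ℝ) < Real.log 3 := by
      rw [Real.lt_log_iff_exp_lt (by norm_num)]
      exact Real.exp_one_lt_d9.trans (by norm_num)
    exact h3.trans_le (Real.log_le_log (by norm_num) hp3R)
  have hL0 : 0 < L := by linarith
  have hX1 : (1.38 : ℝ) ≤ X := (loglog_max_four_bounds (S.sup id)).1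
  have hℓ : (0.27 : ℝ) ≤ Real.log X := (loglog_max_four_bounds (S.sup id)).2
  have hX0 : 0 < X := by linarith
  have hl2 : (0 : ℝ) < Real.log 2 := Real.log_pos (by norm_num)
  have hl2' : Real.log 2 < 1 := by have := Real.log_two_lt_d9; linarith
  have hq2R : ∀ j, (2 : ℝ) ≤ q j := fun j => by exact_mod_cast (hqP j).two_le
  have hlogq : ∀ j, Real.log 2 ≤ Real.log (q j : ℝ) := fun j =>
    Real.log_le_log (by norm_num) (hq2R j)
  -- the engine's hypotheses
  have h1 : ∀ j, α j ≠ 0 ∧ padicValRat p (α j) = 0 := fun j =>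
    ⟨by simp only [hα]; exact_mod_cast (hqP j).ne_zero,
      Literature.Barriers.ABC.StewartTijdemanGeneric.padicValRat_natCast_prime_of_ne hp (hqP j) (hqp j)⟩
  have h2 : ∀ μ : Fin m → ℤ, ∏ j, α j ^ μ j = 1 → μ = 0 := fun μ hμ =>
    Literature.Barriers.ABC.StewartTijdemanGeneric.prime_family_zpow_eq_one hqP hinj hμ
  have h3 : ∀ T : Finset (Fin m), T.Nonempty →
      ¬ IsSquare (∏ j ∈ T, α j) ∧ ¬ IsSquare (-∏ j ∈ T, α j) := fun T hT =>
    not_isSquare_prod_distinct_primes q hqP hinj T hT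
  have h4 : ∀ j, logHeight₁ (α j) ≤ V j := by
    intro j
    haveI : NeZero (q j) := ⟨(hqP j).ne_zero⟩
    have hh : logHeight₁ (α j) = Real.log (q j) := by
      simp only [hα]; exact Rat.logHeight₁_natCast (q j)
    rw [hh]
  have h5 : ∀ j, Real.log 2 ≤ V j := fun j => hlogq j
  have h6 : ∀ j, V j ≤ Vmax := by
    intro j
    have hle : (q j : ℝ) ≤ M4 := by
      rw [hM4]
      have : q j ≤ max 4 (S.sup id) := le_trans (Finset.le_sup (f := id) (hqS j)) (le_max_right _ _)
      exact_mod_cast this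
    exact Real.log_le_log (by linarith [hq2R j]) hle
  have hprodQ : ∏ j, α j ^ b j = ∏ x ∈ S, (x : ℚ) ^ e x := hreidx (fun x => (x : ℚ) ^ e x)
  have h7 : b ≠ 0 := by
    intro h0
    apply hne1
    rw [← hprodQ]
    exact Finset.prod_eq_one fun j _ => by rw [show b j = 0 from congrFun h0 j, zpow_zero]
  have hB1 : 1 ≤ Real.log B := by
    have h3 : (1 : ℝ) < Real.log 3 := by
      rw [Real.lt_log_iff_exp_lt (by norm_num)]
      exact Real.exp_one_lt_d9.trans (by norm_num)
    exact h3.le.trans (Real.log_le_log (by norm_num) hB)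
  have h8 : ∀ j, Real.log (max 3 (|b j| : ℝ)) ≤ W := by
    intro j
    have hle : max 3 (|b j| : ℝ) ≤ B := max_le hB (by simp only [hb]; exact heB _ (hqS j))
    exact Real.log_le_log (lt_of_lt_of_le (by norm_num) (le_max_left _ _)) hle
  -- the engine
  have key := hA p hp hp2 m α b V Vmax W h1 h2 h3 h4 h5 h6 h7 h8
  rw [hprodQ] at key
  -- `∏ Vⱼ = ∏_{q ∈ S} log q`
  set PL : ℝ := ∏ x ∈ S, Real.log (x : ℝ) with hPL
  have hPV : ∏ j, V j = PL := by
    rw [hPL, ← hreidx (fun x => Real.log (x : ℝ))]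
  have hPL0 : 0 < PL := by
    rw [← hPV]; exact Finset.prod_pos fun j _ => lt_of_lt_of_le hl2 (hlogq j)
  -- the garbage: `W + L + log(2X) ≤ 2 (L + W + log X)`
  set Q : ℝ := L + W + Real.log X with hQ
  have hQ0 : 0 < Q := by rw [hQ]; linarith
  have hlog2X : Real.log (2 * Vmax) = Real.log 2 + Real.log X := by
    rw [hVmax, Real.log_mul (by norm_num) hX0.ne']
  have hgarb : W + Real.log p + Real.log (2 * Vmax) ≤ 2 * Q := by
    rw [hlog2X, ← hL, hQ]; linarith
  -- assemble: `v·L ≤ C (p/L) PL (W + L + log 2X) ≤ 2 C (p/L) PL Q ≤ 2 c₁^m (p/L) Q PL < (3c₁)^m (p/L) Q PL`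
  set v : ℝ := (padicValRat p (∏ x ∈ S, (x : ℚ) ^ e x - 1) : ℝ) with hv
  have hCm := hC m
  have hpL : 0 < (p : ℝ) / L := div_pos hpR0 hL0
  have hstep1 : v * L ≤ C m * ((p : ℝ) / L) * PL * (2 * Q) := by
    have h0 : 0 ≤ C m * ((p : ℝ) / L) * PL := mul_nonneg (mul_nonneg hCm.1 hpL.le) hPL0.le
    calc v * L ≤ C m * ((p : ℝ) / L) * (∏ j, V j) * (W + Real.log p + Real.log (2 * Vmax)) := key
      _ = C m * ((p : ℝ) / L) * PL * (W + Real.log p + Real.log (2 * Vmax)) := by rw [hPV]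
      _ ≤ C m * ((p : ℝ) / L) * PL * (2 * Q) := mul_le_mul_of_nonneg_left hgarb h0
  have hstep2 : C m * ((p : ℝ) / L) * PL * (2 * Q) ≤ 2 * c₁ ^ m * (((p : ℝ) / L) * Q * PL) := by
    have h0 : 0 ≤ ((p : ℝ) / L) * Q * PL := by positivity
    calc C m * ((p : ℝ) / L) * PL * (2 * Q) = C m * (2 * (((p : ℝ) / L) * Q * PL)) := by ring
      _ ≤ c₁ ^ m * (2 * (((p : ℝ) / L) * Q * PL)) := mul_le_mul_of_nonneg_right hCm.2 (by positivity)
      _ = 2 * c₁ ^ m * (((p : ℝ) / L) * Q * PL) := by ring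
  have henv : 2 * c₁ ^ m < (3 * c₁) ^ m := by
    have hc0 : 0 < c₁ ^ m := by positivity
    have h3 : (2 : ℝ) < 3 ^ m := by
      calc (2 : ℝ) < 3 := by norm_num
        _ = 3 ^ 1 := (pow_one _).symm
        _ ≤ 3 ^ m := pow_le_pow_right₀ (by norm_num) hm1
    calc 2 * c₁ ^ m < 3 ^ m * c₁ ^ m := mul_lt_mul_of_pos_right h3 hc0
      _ = (3 * c₁) ^ m := by rw [mul_pow]
  calc v * L ≤ C m * ((p : ℝ) / L) * PL * (2 * Q) := hstep1
    _ ≤ 2 * c₁ ^ m * (((p : ℝ) / L) * Q * PL) := hstep2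
    _ < (3 * c₁) ^ m * (((p : ℝ) / L) * Q * PL) :=
        mul_lt_mul_of_pos_right henv (mul_pos (mul_pos hpL hQ0) hPL0)
    _ = (3 * c₁) ^ m * ((p : ℝ) / L) * (L + W + Real.log X) * PL := by rw [hQ]; ring

end YuOhSeven

end Summit.ABC.StewartYu

end
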